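import Summits.Ventures.WeilGRH.ZetaWindowPhaseBlind
import Summits.Ventures.WeilGRH.ZetaGramAtoms
import Literature.NumberTheory.LFunctions.SimpleZeros
import HarnessLib

/-!
# rh-explicit (venture WeilGRH): RH ⟹ EVERY ZERO OF `ζ` WITH `3 ≤ |Im ρ| ≤ 50` IS SIMPLE — by the positivity
  of ONE window, without a prime phase or a zero ordinate

Cell `rh-explicit`, WEIL TRACK (structure seat weil-3, gen11).  The RH corollary of
`ZetaWindowPhaseBlind.lean`.  Under RH the zero-counting measure `ν_ζ = Σ_ρ m_ρ δ_γ` represents Weil's form on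
every window (`WeilBochnerRepresentationRH.weilQuadratic_eq_integral_of_riemannHypothesis`) and its atoms
are the multiplicities (`ZetaGramAtoms.zetaZeroHeightMeasure_singleton_of_riemannHypothesis`); the frontier
window `a₀ = 4023/5000` modulated to height `γ` has window form `< 4a₀` for every `3 ≤ |γ| ≤ 50` whatever the
prime phases (`ZetaWindowPhaseBlind.zetaAtom_frontier_lt_two`).  Hence:

* **`zetaZeroOrder_le_one_of_riemannHypothesis`**: RH ⟹ `ord_{s=½+iγ} ζ(s) ≤ 1` for every `3 ≤ |γ| ≤ 50`;
* **`deriv_riemannZeta_ne_zero_of_riemannHypothesis`**: RH ⟹ every zero `ρ` of `ζ` with `3 ≤ |Im ρ| ≤ 50`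
  is simple, `ζ′(ρ) ≠ 0` (classically: the ten lowest zeros `γ₁ = 14.13…, …, γ₁₀ = 49.77…` and their
  conjugates);
* RH-free companions of `ZetaWindowPhaseBlind.zetaAtom_frontier_lt_two` kept here for size: `phaseBlindBudget_frontier_lt_six`
  (budget `< 6a₀` on `3 ≤ u ≤ 256`), **`zetaAtom_frontier_lt_three`** (every Weil measure of the frontier rung has
  `μ{τ} < 3` on `3 ≤ |τ| ≤ 256`), **`zetaAtom_frontier_le`** (`2a₀μ{τ} ≤ log(|τ|/2π) + 1.0566 + 7.91/τ² + (2/|τ|+2/τ²)/a₀`,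
  all `|τ| ≥ 2`: an explicit `0.311·log|τ| + O(1)` law for EVERY positive-definite extension of the proved rung);
* `zetaZeroOrder_le_two_of_riemannHypothesis`: RH ⟹ `ord_{½+iγ}ζ ≤ 2` for every `3 ≤ |γ| ≤ 256`;
* **`zetaZeroOrder_le_explicit_of_riemannHypothesis`** (every height `|γ| ≥ 2`):
  `2a₀·ord_{½+iγ}ζ ≤ log(|γ|/(2π)) + 1.0566 + 7.91/γ² + (2/|γ| + 2/γ²)/a₀`, i.e.
  `ord ≤ 0.3107·log|γ| + 0.09 + 1.6/|γ| + 6.5/γ²` — an explicit multiplicity bound valid from `|γ| = 2` (the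
  asymptotic `(½+o(1))log γ/log log γ` of Goldston–Gonek is `ZetaMultiplicityBound`).

The simplicity of the low zeros is classical numerically and printed far beyond this radius (Platt, Math. Comp. 86
(2017) Thm 5.1: every zero with `|Im ρ| ≤ 3.06·10¹⁰` is simple and on the line, by Turing's method);
what the theorem records is the MECHANISM — positivity of one window of half-length `0.8046`, the sizes of
`Λ(n)/√n` for `n = 2, 3, 4`, and the archimedean weight `log(|γ|/2π)`, with no phase `cos(γ log n)`, no zero
ordinate and no floating-point input — and that it is kernel-checked.

No definitions, no named facts; RH is a hypothesis exactly where stated (`_of_riemannHypothesis`).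
-/

set_option autoImplicit false

noncomputable section

open Complex Filter Set MeasureTheory
open scoped Real Topology ArithmeticFunction.vonMangoldt

namespace Summit.Ventures.WeilGRH

open Literature.NumberTheory.LFunctions
open Literature.NumberTheory.LFunctions.Yoshida1992 (chi)
open Literature.NumberTheory.LFunctions.WeilBochner (zetaZeroHeightMeasure)
open Literature.NumberTheory.LFunctions.ZetaZeros (riemannZetaNontrivialZeros)

/-! ## RH-free: the frontier window certificate (phase-blind, `3 ≤ |τ| ≤ 50`) -/

/-- **`W_{a₀}(e^{−iτx}χ_0) < 4a₀` FOR EVERY `3 ≤ |τ| ≤ 50`** at the frontier rung `a₀ = 4023/5000` — whatever the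
prime phases `cos(τ log 2), cos(τ log 3)`: the window form of the frontier window modulated to any height in
`[3, 50]` is less than twice its value `2a₀` on a unit atom. -/
theorem weilWindowForm_frontier_lt {τ : ℝ} (h3 : 3 ≤ |τ|) (h50 : |τ| ≤ 50) :
    weilWindowForm (4023 / 5000) (fun x ↦ cexp (I * ((-τ) * x : ℝ)) * chi (4023 / 5000) 0 x) <
      4 * (4023 / 5000 : ℝ) := by
  have hτ2 : 2 ≤ |τ| := by linarith
  have hτ0 : τ ≠ 0 := abs_pos.1 (by linarith)
  have h := weilWindowForm_modulated_le_phaseBlind (a := 4023 / 5000) (by norm_num) hτ2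
  have hP := pole_frontier_le hτ0
  have hS := two_mul_flatSum_frontier_le
  have hB := phaseBlindBudget_frontier_lt h3 h50
  have hsq : τ ^ 2 = |τ| ^ 2 := (sq_abs τ).symm
  rw [show (4023 / 5000 : ℝ) / 2 = 4023 / 5000 / 2 by norm_num] at h
  rw [hsq] at h hP
  linarith

/-- **EVERY WEIL MEASURE OF THE FRONTIER RUNG HAS ALL ATOMS `< 2` AT HEIGHTS `3 ≤ |τ| ≤ 50`** (RH-free).  Let
`μ` be any positive measure representing Weil's form on the tests of `[-a₀, a₀]`, `a₀ = 4023/5000` — such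
measures exist unconditionally (`EvenWinsBeyondArch.weilPositivityOn_8046` and Bochner's theorem,
`WeilBochnerRepresentation`).  Then `μ{τ} < 2` for every `3 ≤ |τ| ≤ 50`.  Under RH, `μ = ν_ζ` gives: every zero
`½ + iγ` of `ζ` with `3 ≤ |γ| ≤ 50` is simple (`ZetaLowZerosSimple.lean`). -/
theorem zetaAtom_frontier_lt_two {μ : Measure ℝ}
    (hμ : ∀ g : ℝ → ℂ, IsWeilTest g → tsupport g ⊆ Icc (-(4023 / 5000 : ℝ)) (4023 / 5000) →
      Integrable (fun t : ℝ ↦ ‖weilMellin g (1 / 2 + t * I)‖ ^ 2) μ ∧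
        weilQuadratic g = ((∫ t, ‖weilMellin g (1 / 2 + t * I)‖ ^ 2 ∂μ : ℝ) : ℂ))
    {τ : ℝ} (h3 : 3 ≤ |τ|) (h50 : |τ| ≤ 50) : μ.real {τ} < 2 := by
  have hτ2 : 2 ≤ |τ| := by linarith
  have hτ0 : τ ≠ 0 := abs_pos.1 (by linarith)
  have h := two_mul_mul_zetaAtom_le_phaseBlind (a := 4023 / 5000) (by norm_num) hμ hτ2
  have hP := pole_frontier_le hτ0
  have hS := two_mul_flatSum_frontier_le
  have hB := phaseBlindBudget_frontier_lt h3 h50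
  have hsq : τ ^ 2 = |τ| ^ 2 := (sq_abs τ).symm
  rw [show (4023 / 5000 : ℝ) / 2 = 4023 / 5000 / 2 by norm_num] at h
  rw [hsq] at h hP
  nlinarith

/-! ## RH-free: the `k = 2` range and the explicit law of the frontier rung -/

/-- **The phase-blind budget of the frontier window is below `6a₀` on `3 ≤ u ≤ 256`** (multiplicity `≤ 2`
range; pieces `[3,50]` (from `phaseBlindBudget_frontier_lt`), `[50,100]`, `[100,256]`; margin `0.038` at `256`). -/
theorem phaseBlindBudget_frontier_lt_six {u : ℝ} (h3 : 3 ≤ u) (h256 : u ≤ 256) :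
    Real.log (u / (2 * π)) + 2 / u ^ 2 + (2 / u + 2 / u ^ 2) / (4023 / 5000) + 5.91 / u ^ 2 + 1.0566 <
      6 * (4023 / 5000 : ℝ) := by
  have hl2 := Real.log_two_gt_d9
  have hl2' := Real.log_two_lt_d9
  obtain ⟨-, hl5⟩ := KadiriNumerics.log_5_bounds
  obtain ⟨hlpi, -⟩ := KadiriNumerics.log_pi_bounds
  rcases le_or_gt u 50 with h50 | h50
  · have := phaseBlindBudget_frontier_lt h3 h50; linarith
  have hlog100 : Real.log 100 = 2 * Real.log 2 + 2 * Real.log 5 := by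
    rw [show (100 : ℝ) = 2 ^ 2 * 5 ^ 2 by norm_num, Real.log_mul (by norm_num) (by norm_num), Real.log_pow,
      Real.log_pow]
    norm_num
  have hlog256 : Real.log 256 = 8 * Real.log 2 := by
    rw [show (256 : ℝ) = 2 ^ 8 by norm_num, Real.log_pow]; norm_num
  rcases le_or_gt u 100 with h100 | h100
  · have hp := phaseBlindBudget_piece_le (by norm_num : (0 : ℝ) < 50) h50.le h100
    rw [hlog100] at hp
    norm_num at hp ⊢
    linarith
  · have hp := phaseBlindBudget_piece_le (by norm_num : (0 : ℝ) < 100) h100.le h256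
    rw [hlog256] at hp
    norm_num at hp ⊢
    linarith

/-- **Every Weil measure of the frontier rung has all atoms `< 3` at heights `3 ≤ |τ| ≤ 256`** (RH-free; under
RH: every zero of `ζ` with `3 ≤ |γ| ≤ 256` has multiplicity `≤ 2`). -/
theorem zetaAtom_frontier_lt_three {μ : Measure ℝ}
    (hμ : ∀ g : ℝ → ℂ, IsWeilTest g → tsupport g ⊆ Icc (-(4023 / 5000 : ℝ)) (4023 / 5000) →
      Integrable (fun t : ℝ ↦ ‖weilMellin g (1 / 2 + t * I)‖ ^ 2) μ ∧
        weilQuadratic g = ((∫ t, ‖weilMellin g (1 / 2 + t * I)‖ ^ 2 ∂μ : ℝ) : ℂ))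
    {τ : ℝ} (h3 : 3 ≤ |τ|) (h256 : |τ| ≤ 256) : μ.real {τ} < 3 := by
  have hτ2 : 2 ≤ |τ| := by linarith
  have hτ0 : τ ≠ 0 := abs_pos.1 (by linarith)
  have h := two_mul_mul_zetaAtom_le_phaseBlind (a := 4023 / 5000) (by norm_num) hμ hτ2
  have hP := pole_frontier_le hτ0
  have hS := two_mul_flatSum_frontier_le
  have hB := phaseBlindBudget_frontier_lt_six h3 h256
  have hsq : τ ^ 2 = |τ| ^ 2 := (sq_abs τ).symm
  rw [show (4023 / 5000 : ℝ) / 2 = 4023 / 5000 / 2 by norm_num] at h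
  rw [hsq] at h hP
  nlinarith

/-- **THE EXPLICIT MULTIPLICITY LAW OF THE FRONTIER RUNG** (RH-free, every height `|τ| ≥ 2`): every positive
measure representing Weil's form on the tests of `[-a₀, a₀]` satisfies

  `2a₀·μ{τ} ≤ log(|τ|/(2π)) + 1.0566 + 7.91/τ² + (2/|τ| + 2/τ²)/a₀`,

i.e. `μ{τ} ≤ 0.3107·log|τ| + 0.086 + O(1/|τ|)` — for `ν_ζ` under RH an explicit `ord_{½+iγ}ζ ≤ 0.3107 log γ + 0.09 +
1.6/γ + 7/γ²` valid from `γ ≥ 2` (the asymptotic `(½+o(1))log γ/log log γ` of Goldston–Gonek is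
`ZetaMultiplicityBound`). -/
theorem zetaAtom_frontier_le {μ : Measure ℝ}
    (hμ : ∀ g : ℝ → ℂ, IsWeilTest g → tsupport g ⊆ Icc (-(4023 / 5000 : ℝ)) (4023 / 5000) →
      Integrable (fun t : ℝ ↦ ‖weilMellin g (1 / 2 + t * I)‖ ^ 2) μ ∧
        weilQuadratic g = ((∫ t, ‖weilMellin g (1 / 2 + t * I)‖ ^ 2 ∂μ : ℝ) : ℂ))
    {τ : ℝ} (hτ : 2 ≤ |τ|) :
    2 * (4023 / 5000 : ℝ) * μ.real {τ} ≤
      Real.log (|τ| / (2 * π)) + 1.0566 + 7.91 / τ ^ 2 + (2 / |τ| + 2 / τ ^ 2) / (4023 / 5000) := by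
  have hτ0 : τ ≠ 0 := abs_pos.1 (by linarith)
  have h := two_mul_mul_zetaAtom_le_phaseBlind (a := 4023 / 5000) (by norm_num) hμ hτ
  have hP := pole_frontier_le hτ0
  have hS := two_mul_flatSum_frontier_le
  rw [show (4023 / 5000 : ℝ) / 2 = 4023 / 5000 / 2 by norm_num] at h
  have : (7.91 : ℝ) / τ ^ 2 = 2 / τ ^ 2 + 5.91 / τ ^ 2 := by ring
  linarith

/-! ## RH-free: PHASE-LOCKED — the one relation `log 4 = 2 log 2` extends the range to `|τ| ≤ 62.5` -/

/-- `−c₂x − c₄(2x² − 1) ≤ c₂ − c₄` for `x ≥ −1` when `0 ≤ 4c₄ ≤ c₂` (`= −(1+x)(c₂ + 2c₄(x−1)) + …`). -/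
private theorem neg_quad_phase_le {c₂ c₄ x : ℝ} (h4 : 0 ≤ c₄) (h : 4 * c₄ ≤ c₂) (hx1 : -1 ≤ x) :
    -(c₂ * x) - c₄ * (2 * x ^ 2 - 1) ≤ c₂ - c₄ := by
  nlinarith [mul_nonneg (by linarith : (0 : ℝ) ≤ 1 + x) (by nlinarith : (0 : ℝ) ≤ c₂ + 2 * c₄ * (x - 1))]

/-- **THE PHASE-LOCKED PRIME SUM OF THE FRONTIER WINDOW**: for every real `τ`,

  `−2Σ_{n ∈ {2,3,4}} Λ(n)n^{-1/2}(1 − log n/2a₀) cos(τ log n) ≤ 0.8646`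

— using only `cos(τ log 4) = 2cos²(τ log 2) − 1` (the phases of `2` and `4` are locked; `c₂ ≥ 4c₄`, so the worst
case is `cos(τ log 2) = cos(τ log 3) = −1`, `cos(τ log 4) = +1`: `2(c₂ + c₃ − c₄) = 0.8645…`), against the fully
phase-blind `2(c₂ + c₃ + c₄) ≤ 1.0566`.  By Kronecker (`log 2/log 3 ∉ ℚ`) this is the supremum over `τ`. -/
theorem neg_two_mul_cos_flatSum_frontier_le (τ : ℝ) :
    -(2 * (∑ n ∈ weilPrimeIndex (4023 / 5000 : ℝ), (Λ n : ℝ) / Real.sqrt n *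
        ((1 - Real.log n / (2 * (4023 / 5000 : ℝ))) * Real.cos (τ * Real.log n)))) ≤ 0.8646 := by
  rw [sum_weilPrimeIndex_eq_threePrime log_two_lt_frontier
    (by have := KadiriNumerics.log_5_bounds.1; linarith)]
  push_cast
  have hlog4 : Real.log 4 = 2 * Real.log 2 := by
    rw [show (4 : ℝ) = 2 ^ 2 by norm_num, Real.log_pow]; norm_num
  have hcos4 : Real.cos (τ * Real.log 4) = 2 * Real.cos (τ * Real.log 2) ^ 2 - 1 := by
    rw [hlog4, show τ * (2 * Real.log 2) = 2 * (τ * Real.log 2) by ring, Real.cos_two_mul]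
  rw [hcos4, hlog4]
  have hl2 := Real.log_two_gt_d9
  have hl2' := Real.log_two_lt_d9
  obtain ⟨hl3, hl3'⟩ := KadiriNumerics.log_3_bounds
  have hs2 : (1.41421356 : ℝ) ≤ Real.sqrt 2 := Real.le_sqrt_of_sq_le (by norm_num)
  have hs2' : Real.sqrt 2 ≤ 1.41421357 := by
    rw [show (1.41421357 : ℝ) = Real.sqrt (1.41421357 ^ 2) by rw [Real.sqrt_sq (by norm_num)]]
    exact Real.sqrt_le_sqrt (by norm_num)
  have hs3 : (1.7320508 : ℝ) ≤ Real.sqrt 3 := Real.le_sqrt_of_sq_le (by norm_num)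
  have hs2pos : (0 : ℝ) < Real.sqrt 2 := by linarith
  have hs3pos : (0 : ℝ) < Real.sqrt 3 := by linarith
  -- the three coefficients
  have hA1 : Real.log 2 / Real.sqrt 2 ≤ 0.49013 := by rw [div_le_iff₀ hs2pos]; nlinarith
  have hA1lo : 0.49012 ≤ Real.log 2 / Real.sqrt 2 := by rw [le_div_iff₀ hs2pos]; nlinarith
  have hB1 : 1 - Real.log 2 / (2 * (4023 / 5000 : ℝ)) ≤ 0.56926 := by
    have key : (0.43074 : ℝ) ≤ Real.log 2 / (2 * (4023 / 5000)) := by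
      rw [le_div_iff₀ (by norm_num)]; norm_num; linarith
    linarith
  have hB1lo : 0.56925 ≤ 1 - Real.log 2 / (2 * (4023 / 5000 : ℝ)) := by
    have key : Real.log 2 / (2 * (4023 / 5000)) ≤ (0.43075 : ℝ) := by
      rw [div_le_iff₀ (by norm_num)]; norm_num; linarith
    linarith
  have hA2 : Real.log 3 / Real.sqrt 3 ≤ 0.634285 := by rw [div_le_iff₀ hs3pos]; nlinarith
  have hA2' : 0 ≤ Real.log 3 / Real.sqrt 3 := div_nonneg (by linarith) hs3pos.le
  have hB2 : 1 - Real.log 3 / (2 * (4023 / 5000 : ℝ)) ≤ 0.317293 := by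
    have key : (0.682707 : ℝ) ≤ Real.log 3 / (2 * (4023 / 5000)) := by
      rw [le_div_iff₀ (by norm_num)]; norm_num; linarith
    linarith
  have hB2' : 0 ≤ 1 - Real.log 3 / (2 * (4023 / 5000 : ℝ)) := by
    rw [sub_nonneg, div_le_one (by norm_num)]; linarith
  have hB3 : 1 - 2 * Real.log 2 / (2 * (4023 / 5000 : ℝ)) ≤ 0.13852 := by
    have key : (0.86148 : ℝ) ≤ 2 * Real.log 2 / (2 * (4023 / 5000)) := by
      rw [le_div_iff₀ (by norm_num)]; norm_num; linarith
    linarith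
  have hB3lo : 0.13851 ≤ 1 - 2 * Real.log 2 / (2 * (4023 / 5000 : ℝ)) := by
    have key : 2 * Real.log 2 / (2 * (4023 / 5000)) ≤ (0.86149 : ℝ) := by
      rw [div_le_iff₀ (by norm_num)]; norm_num; linarith
    linarith
  -- c₂ ≤ 0.279012, c₂ ≥ 0.279, c₃ ≤ 0.201255, 0.048 ≤ c₄ ≤ 0.0481
  have hc2 := mul_le_mul hA1 hB1 (by linarith) (by norm_num)
  have hc2lo := mul_le_mul hA1lo hB1lo (by norm_num) (by linarith)
  have hc3 := mul_le_mul hA2 hB2 hB2' (by norm_num)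
  have hc4 : Real.log 2 / 2 * (1 - 2 * Real.log 2 / (2 * (4023 / 5000 : ℝ))) ≤ 0.3465736 * 0.13852 :=
    mul_le_mul (by linarith) hB3 (by linarith) (by norm_num)
  have hc4lo : 0.3465735 * 0.13851 ≤ Real.log 2 / 2 * (1 - 2 * Real.log 2 / (2 * (4023 / 5000 : ℝ))) :=
    mul_le_mul (by linarith) hB3lo (by norm_num) (by linarith)
  set c₂ : ℝ := Real.log 2 / Real.sqrt 2 * (1 - Real.log 2 / (2 * (4023 / 5000 : ℝ))) with hc₂
  set c₃ : ℝ := Real.log 3 / Real.sqrt 3 * (1 - Real.log 3 / (2 * (4023 / 5000 : ℝ))) with hc₃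
  set c₄ : ℝ := Real.log 2 / 2 * (1 - 2 * Real.log 2 / (2 * (4023 / 5000 : ℝ))) with hc₄
  set x : ℝ := Real.cos (τ * Real.log 2) with hx
  set y : ℝ := Real.cos (τ * Real.log 3) with hy
  have hx1 : -1 ≤ x := Real.neg_one_le_cos _
  have hy1 : -1 ≤ y := Real.neg_one_le_cos _
  have key1 : -(c₂ * x) - c₄ * (2 * x ^ 2 - 1) ≤ c₂ - c₄ :=
    neg_quad_phase_le (by norm_num at hc4lo ⊢; linarith) (by norm_num at hc2lo hc4 ⊢; linarith) hx1
  have key2 : -(c₃ * y) ≤ c₃ := by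
    have hc3' : 0 ≤ c₃ := mul_nonneg hA2' hB2'
    nlinarith
  have e : -(2 * (Real.log 2 / Real.sqrt 2 * ((1 - Real.log 2 / (2 * (4023 / 5000 : ℝ))) * x) +
        Real.log 3 / Real.sqrt 3 * ((1 - Real.log 3 / (2 * (4023 / 5000 : ℝ))) * y) +
        Real.log 2 / 2 * ((1 - 2 * Real.log 2 / (2 * (4023 / 5000 : ℝ))) * (2 * x ^ 2 - 1)))) =
      2 * ((-(c₂ * x) - c₄ * (2 * x ^ 2 - 1)) + -(c₃ * y)) := by
    rw [hc₂, hc₃, hc₄]; ring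
  rw [e]
  norm_num at hc2 hc3 hc4lo ⊢
  linarith

/-- **The phase-locked budget of the frontier window is below `4a₀` on `3 ≤ u ≤ 62.5`** (pieces `[3,50]` from the
phase-blind lemma, `[50,60]`, `[60,62.5]`; margin `0.012` at the top). -/
theorem phaseLockedBudget_frontier_lt {u : ℝ} (h3 : 3 ≤ u) (h : u ≤ 125 / 2) :
    Real.log (u / (2 * π)) + 2 / u ^ 2 + (2 / u + 2 / u ^ 2) / (4023 / 5000) + 5.91 / u ^ 2 + 0.8646 <
      4 * (4023 / 5000 : ℝ) := by
  have hl2 := Real.log_two_gt_d9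
  have hl2' := Real.log_two_lt_d9
  obtain ⟨-, hl3⟩ := KadiriNumerics.log_3_bounds
  obtain ⟨-, hl5⟩ := KadiriNumerics.log_5_bounds
  obtain ⟨hlpi, -⟩ := KadiriNumerics.log_pi_bounds
  rcases le_or_gt u 50 with h50 | h50
  · have := phaseBlindBudget_frontier_lt h3 h50; linarith
  have hlog60 : Real.log 60 = 2 * Real.log 2 + Real.log 3 + Real.log 5 := by
    rw [show (60 : ℝ) = 2 ^ 2 * 3 * 5 by norm_num, Real.log_mul (by norm_num) (by norm_num),
      Real.log_mul (by norm_num) (by norm_num), Real.log_pow]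
    norm_num
  have hlog625 : Real.log (125 / 2) = 3 * Real.log 5 - Real.log 2 := by
    rw [Real.log_div (by norm_num) (by norm_num), show (125 : ℝ) = 5 ^ 3 by norm_num, Real.log_pow]
    norm_num
  rcases le_or_gt u 60 with h60 | h60
  · have hp := phaseBlindBudget_piece_le (by norm_num : (0 : ℝ) < 50) h50.le h60
    rw [hlog60] at hp
    norm_num at hp ⊢
    linarith
  · have hp := phaseBlindBudget_piece_le (by norm_num : (0 : ℝ) < 60) h60.le h
    rw [hlog625] at hp
    norm_num at hp ⊢
    linarith

/-- **`W_{a₀}(e^{−iτx}χ_0) < 4a₀` FOR EVERY `3 ≤ |τ| ≤ 62.5`**, phase-locked: no prime phase is evaluated, only the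
relation `log 4 = 2 log 2` among them is used. -/
theorem weilWindowForm_frontier_lt_of_le {τ : ℝ} (h3 : 3 ≤ |τ|) (h : |τ| ≤ 125 / 2) :
    weilWindowForm (4023 / 5000) (fun x ↦ cexp (I * ((-τ) * x : ℝ)) * chi (4023 / 5000) 0 x) <
      4 * (4023 / 5000 : ℝ) := by
  have hτ2 : 2 ≤ |τ| := by linarith
  have hτ0 : τ ≠ 0 := abs_pos.1 (by linarith)
  have hW := weilWindowForm_modulated_le_archBlind (a := 4023 / 5000) (by norm_num) hτ2
  have hP := pole_frontier_le hτ0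
  have hS := neg_two_mul_cos_flatSum_frontier_le τ
  have hB := phaseLockedBudget_frontier_lt h3 h
  have hsq : τ ^ 2 = |τ| ^ 2 := (sq_abs τ).symm
  rw [show (4023 / 5000 : ℝ) / 2 = 4023 / 5000 / 2 by norm_num] at hW
  rw [hsq] at hW hP
  linarith

/-- **EVERY WEIL MEASURE OF THE FRONTIER RUNG HAS ALL ATOMS `< 2` AT HEIGHTS `3 ≤ |τ| ≤ 62.5`** (RH-free,
phase-locked; under RH: the fourteen lowest zeros of `ζ`, `γ₁ = 14.13 … γ₁₄ = 60.83`, are simple). -/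
theorem zetaAtom_frontier_lt_two_of_le {μ : Measure ℝ}
    (hμ : ∀ g : ℝ → ℂ, IsWeilTest g → tsupport g ⊆ Icc (-(4023 / 5000 : ℝ)) (4023 / 5000) →
      Integrable (fun t : ℝ ↦ ‖weilMellin g (1 / 2 + t * I)‖ ^ 2) μ ∧
        weilQuadratic g = ((∫ t, ‖weilMellin g (1 / 2 + t * I)‖ ^ 2 ∂μ : ℝ) : ℂ))
    {τ : ℝ} (h3 : 3 ≤ |τ|) (h : |τ| ≤ 125 / 2) : μ.real {τ} < 2 := by
  have hτ2 : 2 ≤ |τ| := by linarith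
  have hτ0 : τ ≠ 0 := abs_pos.1 (by linarith)
  have hW := two_mul_mul_zetaAtom_le_archBlind (a := 4023 / 5000) (by norm_num) hμ hτ2
  have hP := pole_frontier_le hτ0
  have hS := neg_two_mul_cos_flatSum_frontier_le τ
  have hB := phaseLockedBudget_frontier_lt h3 h
  have hsq : τ ^ 2 = |τ| ^ 2 := (sq_abs τ).symm
  rw [show (4023 / 5000 : ℝ) / 2 = 4023 / 5000 / 2 by norm_num] at hW
  rw [hsq] at hW hP
  nlinarith

/-! ## Under RH: the low zeros are simple -/

/-- Under RH, `ν_ζ` represents Weil's form on the tests of every window (the hypothesis shape of the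
`ZetaWindowAtoms` family). -/
private theorem zetaZeroHeightMeasure_represents (hRH : RiemannHypothesis) (a : ℝ) :
    ∀ g : ℝ → ℂ, IsWeilTest g → tsupport g ⊆ Icc (-a) a →
      Integrable (fun t : ℝ ↦ ‖weilMellin g (1 / 2 + t * I)‖ ^ 2) zetaZeroHeightMeasure ∧
        weilQuadratic g = ((∫ t, ‖weilMellin g (1 / 2 + t * I)‖ ^ 2 ∂zetaZeroHeightMeasure : ℝ) : ℂ) :=
  fun _ hg _ ↦ WeilBochner.weilQuadratic_eq_integral_of_riemannHypothesis hRH hg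

/-- **RH ⟹ `ord_{s=½+iγ} ζ(s) ≤ 1` FOR EVERY `3 ≤ |γ| ≤ 62.5`** — the frontier window `a₀ = 4023/5000` modulated
to height `γ`, read phase-locked (`zetaAtom_frontier_lt_two_of_le` with `μ = ν_ζ`). -/
theorem zetaZeroOrder_le_one_of_riemannHypothesis (hRH : RiemannHypothesis) {γ : ℝ} (h3 : 3 ≤ |γ|)
    (h62 : |γ| ≤ 125 / 2) : riemannZetaZeroOrder (1 / 2 + γ * I) ≤ 1 := by
  have h := zetaAtom_frontier_lt_two_of_le (zetaZeroHeightMeasure_represents hRH (4023 / 5000)) h3 h62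
  rw [measureReal_def, zetaZeroHeightMeasure_singleton_of_riemannHypothesis hRH, ENNReal.toReal_natCast] at h
  have h2 : (riemannZetaZeroOrder (1 / 2 + γ * I)).toNat < 2 := by exact_mod_cast h
  have h1 : (riemannZetaZeroOrder (1 / 2 + γ * I)).toNat ≤ 1 := by omega
  exact (Int.toNat_le.1 h1).trans (by norm_num)

/-- **RH ⟹ EVERY ZERO OF `ζ` WITH `3 ≤ |Im ρ| ≤ 62.5` IS SIMPLE**: `ζ(ρ) = 0`, `3 ≤ |Im ρ| ≤ 125/2` ⟹ `ζ′(ρ) ≠ 0`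
(a zero off the real axis is non-trivial, so under RH `ρ = ½ + iγ`; its order is `≥ 1` and, by the window, `≤ 1`;
order one is `ζ′(ρ) ≠ 0`, `SimpleZeros.riemannZetaZeroOrder_eq_one_iff_deriv_ne_zero`).  Classically these
are the fourteen lowest zeros of `ζ` (`γ₁ = 14.13, …, γ₁₄ = 60.83`) and their conjugates. -/
theorem deriv_riemannZeta_ne_zero_of_riemannHypothesis (hRH : RiemannHypothesis) {ρ : ℂ}
    (hζ : riemannZeta ρ = 0) (h3 : 3 ≤ |ρ.im|) (h62 : |ρ.im| ≤ 125 / 2) : deriv riemannZeta ρ ≠ 0 := by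
  have him : ρ.im ≠ 0 := fun h ↦ by rw [h, abs_zero] at h3; linarith
  have hmem : ρ ∈ riemannZetaNontrivialZeros := ZetaZeros.riemannZetaNontrivialZeros.mem_of_im_ne_zero hζ him
  have hre : ρ.re = 1 / 2 := by
    refine hRH ρ hζ ?_ (ZetaZeros.riemannZetaNontrivialZeros.ne_one hmem)
    rintro ⟨k, hk⟩
    have h0 := ZetaZeros.riemannZetaNontrivialZeros.re_pos hmem
    have e : (-2 * ((k : ℂ) + 1)).re = -2 * ((k : ℝ) + 1) := by simp
    rw [hk, e] at h0
    have : (0 : ℝ) ≤ k := k.cast_nonneg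
    linarith
  have hρ : ρ = 1 / 2 + ρ.im * I := by
    apply Complex.ext <;> simp [hre]
  have hle := zetaZeroOrder_le_one_of_riemannHypothesis hRH h3 h62
  rw [← hρ] at hle
  have hge := ZetaZeros.riemannZetaNontrivialZeros.one_le_order hmem
  exact (riemannZetaZeroOrder_eq_one_iff_deriv_ne_zero hmem).1 (le_antisymm hle hge)

/-- **RH ⟹ `ord_{s=½+iγ} ζ(s) ≤ 2` for every `3 ≤ |γ| ≤ 256`** (the same window; budget `< 6a₀`). -/
theorem zetaZeroOrder_le_two_of_riemannHypothesis (hRH : RiemannHypothesis) {γ : ℝ} (h3 : 3 ≤ |γ|)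
    (h256 : |γ| ≤ 256) : riemannZetaZeroOrder (1 / 2 + γ * I) ≤ 2 := by
  have h := zetaAtom_frontier_lt_three (zetaZeroHeightMeasure_represents hRH (4023 / 5000)) h3 h256
  rw [measureReal_def, zetaZeroHeightMeasure_singleton_of_riemannHypothesis hRH, ENNReal.toReal_natCast] at h
  have h2 : (riemannZetaZeroOrder (1 / 2 + γ * I)).toNat < 3 := by exact_mod_cast h
  have h1 : (riemannZetaZeroOrder (1 / 2 + γ * I)).toNat ≤ 2 := by omega
  exact (Int.toNat_le.1 h1).trans (by norm_num)

/-- **RH ⟹ AN EXPLICIT MULTIPLICITY BOUND AT EVERY HEIGHT `|γ| ≥ 2`** (frontier window, phase-blind):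

  `2a₀ · ord_{s=½+iγ} ζ(s) ≤ log(|γ|/(2π)) + 1.0566 + 7.91/γ² + (2/|γ| + 2/γ²)/a₀`,  `a₀ = 4023/5000`. -/
theorem zetaZeroOrder_le_explicit_of_riemannHypothesis (hRH : RiemannHypothesis) {γ : ℝ} (hγ : 2 ≤ |γ|) :
    2 * (4023 / 5000 : ℝ) * ((riemannZetaZeroOrder (1 / 2 + γ * I)).toNat : ℝ) ≤
      Real.log (|γ| / (2 * π)) + 1.0566 + 7.91 / γ ^ 2 + (2 / |γ| + 2 / γ ^ 2) / (4023 / 5000) := by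
  have h := zetaAtom_frontier_le (zetaZeroHeightMeasure_represents hRH (4023 / 5000)) hγ
  rwa [measureReal_def, zetaZeroHeightMeasure_singleton_of_riemannHypothesis hRH, ENNReal.toReal_natCast] at h

end Summit.Ventures.WeilGRH

end
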